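/-
Copyright (c) 2026. All rights reserved.
Released under Apache 2.0 license as described in the file LICENSE.
-/
import Summits.ValiantsHypothesis.ValiantsHypothesis.Theorems.ReadOnceCFSupport
import Summits.ValiantsHypothesis.ValiantsHypothesis.Theorems.IsolationRoundsFree
import HarnessLib

/-!
# Read-once determinantal templates with column-sparse constants: support

Companion of `ReadOnceCFSupport` (§5 there: CONSTANT-FREE templates) for templates
`E : Matrix (Fin r) (Fin r) (M ⊕ F)` whose constants are ARBITRARY IN VALUE: the determinant
`D_E = det (E.map (Sum.elim X C))`, its Leibniz terms and its support.
* §1 The PARTIAL LABELLING `optLab E` (the variable at a position, `none` on constants), the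
  ADMISSIBLE relation «column `k` may take row `j`» = `∀ c, E j k = Sum.inr c → c ≠ 0` (variable
  or NON-ZERO constant; always written out), the exponent vector `monoOfO` of a permutation
  (labelled positions only) and the product `∏ k, Sum.elim (fun _ => 1) id (E (σ k) k)` of the
  constants it meets.
* §2 The Leibniz term of ANY permutation is `monomial (monoOfO (optLab E) σ) (∏ constants met)`
  (`prod_entry_eq`); the coefficient formula `coeff_det_eq`.
* §3 UNIQUE COMPLETION (`monoOfO_injOn`): if the variables are READ-ONCE and the non-zero
  constants are COLUMN-SPARSE (at most one per column), admissible permutations are determined by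
  their monomials — so `D_E` is cancellation-free in EVERY degree: its support is exactly the set
  of monomials of admissible permutations (`monoOfO_mem_support`, `exists_perm_of_mem_support`),
  with coefficients `sign σ · ∏ constants met`.
* §4 The hypotheses `hlab` / `hfree` / `hadm` of the free-edge isolation rounds
  (`IsolationRoundsFree`) for the partial labelling: `optLab_inj`, `optLab_free`,
  `exists_adm_of_det_ne_zero`.
Currency: kernel-certified helper for the W4 isolation road (O-L2-19; the free-edge rounds
`IsolationRoundsFree` are imported here for the assembly file); closes no item; data defs
`optLab`, `monoOfO`; no facts/doors. [cite: FennerGurjarThierauf2016,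
Section 3] (isolation of perfect matchings), [cite: ForbesShpilkaVolk2018, §8] (read-once
determinants).
-/

set_option linter.dupNamespace false

namespace Summit.ValiantsHypothesis.ValiantsHypothesis.Theorems.ReadOnceColSparseSupport

open MvPolynomial

noncomputable section

/-! ### §1 Partial labelling, admissibility, monomials and constants of a permutation -/

section Labels

variable {M : Type*} {r : ℕ}

/-- The monomial `∏_{k labelled} x_{lab k (σ k)}` of a permutation under a partial labelling, as
an exponent vector (free positions contribute nothing). [folklore] -/
def monoOfO (lab : Fin r → Fin r → Option M) (σ : Equiv.Perm (Fin r)) : M →₀ ℕ :=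
  ∑ k, (lab k (σ k)).elim 0 fun μ => Finsupp.single μ 1

/-- A variable occurs in the monomial of `σ` iff `σ` passes through a position labelled by it.
[this file] -/
theorem monoOfO_apply_ne_zero {lab : Fin r → Fin r → Option M} {σ : Equiv.Perm (Fin r)} {v : M} :
    monoOfO lab σ v ≠ 0 ↔ ∃ k, lab k (σ k) = some v := by
  classical
  unfold monoOfO
  rw [Finsupp.finsetSum_apply]
  constructor
  · intro h
    obtain ⟨k, -, hk⟩ := Finset.exists_ne_zero_of_sum_ne_zero h
    refine ⟨k, ?_⟩
    cases hk' : lab k (σ k) with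
    | none => rw [hk'] at hk; simp at hk
    | some μ =>
      rw [hk'] at hk
      simp only [Option.elim_some] at hk
      exact congrArg some (Finsupp.single_apply_ne_zero.1 hk).1.symm
  · rintro ⟨k, hk⟩
    refine Nat.pos_iff_ne_zero.1 (lt_of_lt_of_le Nat.one_pos ?_)
    calc 1 = ((lab k (σ k)).elim 0 fun μ => Finsupp.single μ 1 : M →₀ ℕ) v := by
          simp only [hk, Option.elim_some, Finsupp.single_eq_same]
      _ ≤ ∑ k', ((lab k' (σ k')).elim 0 fun μ => Finsupp.single μ 1 : M →₀ ℕ) v :=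
        Finset.single_le_sum
          (f := fun k' => ((lab k' (σ k')).elim 0 fun μ => Finsupp.single μ 1 : M →₀ ℕ) v)
          (fun _ _ => Nat.zero_le _) (Finset.mem_univ k)

/-- The weight of the monomial of `σ` is the weight of the LABELLED part of the matching (free
positions weigh `0`). [folklore] -/
theorem sum_monoOfO (lab : Fin r → Fin r → Option M) (σ : Equiv.Perm (Fin r)) (w : M → ℕ) :
    ((monoOfO lab σ).sum fun μ k => k * w μ) = ∑ k, (lab k (σ k)).elim 0 w := by
  unfold monoOfO
  rw [← Finsupp.sum_finsetSum_index (h := fun μ k => k * w μ) (fun _ => by simp)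
    (fun _ _ _ => by simp [add_mul])]
  refine Finset.sum_congr rfl fun k _ => ?_
  cases lab k (σ k) with
  | none => simp
  | some μ =>
    simp only [Option.elim_some]
    rw [Finsupp.sum_single_index] <;> simp

end Labels

section Template

variable {F : Type*} [Field F] {M : Type*} {r : ℕ}

/-- The PARTIAL LABELLING of a template: the variable at entry `(j, k)`, `none` on constants.
[folklore] -/
def optLab (E : Matrix (Fin r) (Fin r) (M ⊕ F)) (k j : Fin r) : Option M :=
  Sum.elim some (fun _ => none) (E j k)

omit [Field F] in
/-- A position is labelled `μ` iff it holds the variable `μ`. [this file] -/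
theorem optLab_eq_some_iff (E : Matrix (Fin r) (Fin r) (M ⊕ F)) {k j : Fin r} {μ : M} :
    optLab E k j = some μ ↔ E j k = Sum.inl μ := by
  unfold optLab
  cases E j k with
  | inl m => simp
  | inr c => simp

omit [Field F] in
/-- A position is free iff it holds a constant. [this file] -/
theorem optLab_eq_none_iff (E : Matrix (Fin r) (Fin r) (M ⊕ F)) {k j : Fin r} :
    optLab E k j = none ↔ ∃ c, E j k = Sum.inr c := by
  unfold optLab
  cases E j k with
  | inl m => simp
  | inr c => simp

/-- An admissible permutation meets only non-zero constants (the product of the constants met,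
`1` on variable positions, is non-zero). [this file] -/
theorem prodConst_ne_zero {E : Matrix (Fin r) (Fin r) (M ⊕ F)} {σ : Equiv.Perm (Fin r)}
    (hσ : ∀ k, ∀ c : F, E (σ k) k = Sum.inr c → c ≠ 0) :
    ∏ k, Sum.elim (fun _ => (1 : F)) id (E (σ k) k) ≠ 0 := by
  refine Finset.prod_ne_zero_iff.2 fun k _ => ?_
  have hk := hσ k
  cases hE : E (σ k) k with
  | inl μ => simp
  | inr c => simpa using hk c hE

/-- A non-admissible permutation meets a zero constant. [this file] -/
theorem prodConst_eq_zero {E : Matrix (Fin r) (Fin r) (M ⊕ F)} {σ : Equiv.Perm (Fin r)}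
    (hσ : ¬ ∀ k, ∀ c : F, E (σ k) k = Sum.inr c → c ≠ 0) :
    ∏ k, Sum.elim (fun _ => (1 : F)) id (E (σ k) k) = 0 := by
  obtain ⟨k, hk⟩ := not_forall.1 hσ
  push Not at hk
  obtain ⟨c, hE, rfl⟩ := hk
  exact Finset.prod_eq_zero (Finset.mem_univ k) (by simp [hE])

/-! ### §2 Leibniz terms and coefficients -/

/-- Products of monomials. [folklore] -/
theorem prod_monomial_eq {ι : Type*} (s : Finset ι) (m : ι → M →₀ ℕ) (c : ι → F) :
    ∏ k ∈ s, monomial (m k) (c k) = monomial (∑ k ∈ s, m k) (∏ k ∈ s, c k) := by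
  classical
  induction s using Finset.induction_on with
  | empty => simp
  | insert k s hk ih =>
    rw [Finset.prod_insert hk, Finset.sum_insert hk, Finset.prod_insert hk, ih, monomial_mul]

/-- Leibniz term of ANY permutation of a template: its monomial, with coefficient the product of
the constants it meets (`0` through a zero constant). [folklore] -/
theorem prod_entry_eq (E : Matrix (Fin r) (Fin r) (M ⊕ F)) (σ : Equiv.Perm (Fin r)) :
    ∏ k, Sum.elim MvPolynomial.X MvPolynomial.C (E (σ k) k) =
      monomial (monoOfO (optLab E) σ) (∏ k, Sum.elim (fun _ => (1 : F)) id (E (σ k) k)) := by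
  unfold monoOfO
  rw [← prod_monomial_eq]
  refine Finset.prod_congr rfl fun k _ => ?_
  unfold optLab
  cases E (σ k) k with
  | inl μ =>
    show MvPolynomial.X μ = monomial (Finsupp.single μ 1) 1
    rfl
  | inr c =>
    show MvPolynomial.C c = monomial 0 c
    rfl

/-- Coefficients of the determinant of a template: a signed sum of the constants of the
permutations with that monomial. [folklore] -/
theorem coeff_det_eq [DecidableEq M] (E : Matrix (Fin r) (Fin r) (M ⊕ F)) (m : M →₀ ℕ) :
    coeff m (E.map (Sum.elim MvPolynomial.X MvPolynomial.C)).det =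
      ∑ σ ∈ Finset.univ.filter (fun σ : Equiv.Perm (Fin r) => monoOfO (optLab E) σ = m),
        ((Equiv.Perm.sign σ : ℤ) : F) * ∏ k, Sum.elim (fun _ => (1 : F)) id (E (σ k) k) := by
  rw [Matrix.det_apply', MvPolynomial.coeff_sum, Finset.sum_filter]
  refine Finset.sum_congr rfl fun σ _ => ?_
  have hC : ((Equiv.Perm.sign σ : ℤ) : MvPolynomial M F) = C ((Equiv.Perm.sign σ : ℤ) : F) :=
    (map_intCast (C : F →+* MvPolynomial M F) _).symm
  rw [hC, MvPolynomial.coeff_C_mul]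
  simp only [Matrix.map_apply]
  rw [prod_entry_eq, MvPolynomial.coeff_monomial]
  by_cases hm : monoOfO (optLab E) σ = m <;> simp [hm]

/-! ### §3 Unique completion: read-once variables, column-sparse constants -/

/-- UNIQUE COMPLETION.  If the variables of the template are READ-ONCE and its non-zero constants
are COLUMN-SPARSE (at most one per column), two admissible permutations with the same monomial
coincide: a labelled position of one is a position of the other (read-once), and a column that is
free for both holds its unique non-zero constant for both. [this file] -/
theorem monoOfO_injOn (E : Matrix (Fin r) (Fin r) (M ⊕ F))
    (hro : ∀ p q : Fin r × Fin r, ∀ m, E p.1 p.2 = Sum.inl m → E q.1 q.2 = Sum.inl m → p = q)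
    (hcs : ∀ (j j' k : Fin r) (c c' : F), E j k = Sum.inr c → E j' k = Sum.inr c' → c ≠ 0 →
      c' ≠ 0 → j = j')
    {σ τ : Equiv.Perm (Fin r)} (hσ : ∀ k, ∀ c : F, E (σ k) k = Sum.inr c → c ≠ 0)
    (hτ : ∀ k, ∀ c : F, E (τ k) k = Sum.inr c → c ≠ 0)
    (h : monoOfO (optLab E) σ = monoOfO (optLab E) τ) : σ = τ := by
  have key : ∀ {σ τ : Equiv.Perm (Fin r)}, monoOfO (optLab E) σ = monoOfO (optLab E) τ →
      ∀ k μ, optLab E k (σ k) = some μ → τ k = σ k := by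
    intro σ τ h k μ hk
    have hne : monoOfO (optLab E) τ μ ≠ 0 := by
      rw [← h]
      exact monoOfO_apply_ne_zero.2 ⟨k, hk⟩
    obtain ⟨k', hk'⟩ := monoOfO_apply_ne_zero.1 hne
    have hpq := hro (σ k, k) (τ k', k') μ ((optLab_eq_some_iff E).1 hk)
      ((optLab_eq_some_iff E).1 hk')
    simp only [Prod.mk.injEq] at hpq
    obtain ⟨hst, rfl⟩ := hpq
    exact hst.symm
  refine Equiv.ext fun k => ?_
  cases hσk : optLab E k (σ k) with
  | some μ => exact (key h k μ hσk).symm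
  | none =>
    cases hτk : optLab E k (τ k) with
    | some ν => exact key h.symm k ν hτk
    | none =>
      obtain ⟨c, hc⟩ := (optLab_eq_none_iff E).1 hσk
      obtain ⟨c', hc'⟩ := (optLab_eq_none_iff E).1 hτk
      exact hcs (σ k) (τ k) k c c' hc hc' (hσ k c hc) (hτ k c' hc')

/-- No cancellation: the monomial of an admissible permutation is in the support of the
determinant, with coefficient `sign σ · ∏ constants met ≠ 0`. [this file] -/
theorem monoOfO_mem_support (E : Matrix (Fin r) (Fin r) (M ⊕ F))
    (hro : ∀ p q : Fin r × Fin r, ∀ m, E p.1 p.2 = Sum.inl m → E q.1 q.2 = Sum.inl m → p = q)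
    (hcs : ∀ (j j' k : Fin r) (c c' : F), E j k = Sum.inr c → E j' k = Sum.inr c' → c ≠ 0 →
      c' ≠ 0 → j = j')
    {σ : Equiv.Perm (Fin r)} (hσ : ∀ k, ∀ c : F, E (σ k) k = Sum.inr c → c ≠ 0) :
    monoOfO (optLab E) σ ∈ (E.map (Sum.elim MvPolynomial.X MvPolynomial.C)).det.support := by
  classical
  rw [MvPolynomial.mem_support_iff, coeff_det_eq E, Finset.sum_eq_single σ]
  · refine mul_ne_zero ?_ (prodConst_ne_zero hσ)
    rcases Int.units_eq_one_or (Equiv.Perm.sign σ) with h | h <;> simp [h]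
  · intro τ hτ hne
    rw [Finset.mem_filter] at hτ
    by_cases hτa : ∀ k, ∀ c : F, E (τ k) k = Sum.inr c → c ≠ 0
    · exact absurd (monoOfO_injOn E hro hcs hτa hσ hτ.2) hne
    · rw [prodConst_eq_zero hτa, mul_zero]
  · intro h
    exact (h (Finset.mem_filter.2 ⟨Finset.mem_univ _, rfl⟩)).elim

/-- Every monomial in the support comes from an admissible permutation. [folklore] -/
theorem exists_perm_of_mem_support (E : Matrix (Fin r) (Fin r) (M ⊕ F)) {m : M →₀ ℕ}
    (hm : m ∈ (E.map (Sum.elim MvPolynomial.X MvPolynomial.C)).det.support) :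
    ∃ σ : Equiv.Perm (Fin r),
      (∀ k, ∀ c : F, E (σ k) k = Sum.inr c → c ≠ 0) ∧ monoOfO (optLab E) σ = m := by
  classical
  rw [MvPolynomial.mem_support_iff, coeff_det_eq E] at hm
  obtain ⟨σ, hσ, hne⟩ := Finset.exists_ne_zero_of_sum_ne_zero hm
  rw [Finset.mem_filter] at hσ
  refine ⟨σ, ?_, hσ.2⟩
  by_contra hn
  exact hne (by rw [prodConst_eq_zero hn, mul_zero])

/-! ### §4 The hypotheses of the free-edge rounds -/

/-- A non-zero determinant has an admissible permutation (hypothesis `hadm`). [folklore] -/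
theorem exists_adm_of_det_ne_zero (E : Matrix (Fin r) (Fin r) (M ⊕ F))
    (h : (E.map (Sum.elim MvPolynomial.X MvPolynomial.C)).det ≠ 0) :
    ∃ σ : Equiv.Perm (Fin r), ∀ k, ∀ c : F, E (σ k) k = Sum.inr c → c ≠ 0 := by
  obtain ⟨m, hm⟩ := MvPolynomial.ne_zero_iff.1 h
  obtain ⟨σ, hσ, -⟩ := exists_perm_of_mem_support E (MvPolynomial.mem_support_iff.2 hm)
  exact ⟨σ, hσ⟩

/-- Read-once ⇒ the partial labelling is injective on labelled positions (hypothesis `hlab`).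
[cite: ForbesShpilkaVolk2018, §8] -/
theorem optLab_inj (E : Matrix (Fin r) (Fin r) (M ⊕ F))
    (hro : ∀ p q : Fin r × Fin r, ∀ m, E p.1 p.2 = Sum.inl m → E q.1 q.2 = Sum.inl m → p = q) :
    ∀ i j i' j' μ, (∀ c : F, E j i = Sum.inr c → c ≠ 0) → (∀ c : F, E j' i' = Sum.inr c → c ≠ 0) →
      optLab E i j = some μ → optLab E i' j' = some μ → i = i' ∧ j = j' := by
  intro i j i' j' μ _ _ h h'
  have hpq := hro (j, i) (j', i') μ ((optLab_eq_some_iff E).1 h) ((optLab_eq_some_iff E).1 h')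
  simp only [Prod.mk.injEq] at hpq
  exact ⟨hpq.2, hpq.1⟩

/-- Column-sparse non-zero constants ⇒ each column has at most one admissible free position
(hypothesis `hfree`). [this file] -/
theorem optLab_free (E : Matrix (Fin r) (Fin r) (M ⊕ F))
    (hcs : ∀ (j j' k : Fin r) (c c' : F), E j k = Sum.inr c → E j' k = Sum.inr c' → c ≠ 0 →
      c' ≠ 0 → j = j') :
    ∀ i j j', (∀ c : F, E j i = Sum.inr c → c ≠ 0) → (∀ c : F, E j' i = Sum.inr c → c ≠ 0) →
      optLab E i j = none → optLab E i j' = none → j = j' := by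
  intro i j j' hj hj' h h'
  obtain ⟨c, hc⟩ := (optLab_eq_none_iff E).1 h
  obtain ⟨c', hc'⟩ := (optLab_eq_none_iff E).1 h'
  exact hcs j j' i c c' hc hc' (hj c hc) (hj' c' hc')

end Template

end

end Summit.ValiantsHypothesis.ValiantsHypothesis.Theorems.ReadOnceColSparseSupport
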